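import Summits.AnomalousDissipation.AnomalousDissipation.Theorems.SolenoidalFractalHomogenisationLagrangianStepZFloor
import Summits.AnomalousDissipation.AnomalousDissipation.Theorems.SolenoidalFractalHomogenisationLagrangianStepZAssembly
import HarnessLib

/-!
# K1L_D (stmt-AnomalousDissipation-27980), stub `stub_windowFactsH`: the (Z) BLOCK — from the four cell-side pieces and the two W3-E (i) bounds to
# the dissipation-weighted duality bound (helper; `--supports … --as helper`; lead-k1l-onelevel-p1 g3)

Glue between the landed consumer algebra (`z_of_pieces` …ZAssembly p669953, `floor_of_dissipBound` …ZFloor p670193) and the INPUT TEXTS of the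
final assembly of `stub_windowFactsH` (split v28: §4c W3-E (i) = the dissipation bound `‖T y‖² ≤ ‖y‖² − ½ Σ' min(1, rate_k τ)‖𝓕y(k)‖²` for `T`
and `T†`; §9 (Zin) = the splitting `P(Uu − Tu) = e_d + e_c + e_l + e_f` with its four bounds on the slow-low set `S = freqBall L ∖ {0}`).
Two book-keeping points are settled here: (1) the ZERO MODE — never dissipated (`rate_0 = 0`) — is removed from the test vector `y` by the
zero-mode projector `P₀` (`⟪P₀ y, e⟫ = 0` because `e` has no mean, `𝓕e(0) = 0`, an input discharged by …MeanZero), and the floors are proved for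
the mean-free parts (`floor_meanfree`); (2) every mode OFF the ball `freqBall L` is fully dissipated in the window (`rate_k τ ≥ 1`, an input), so
the W3-E weights are `1` off `S ∪ {0}` as `floor_of_dissipBound` wants.  Output: `|⟪y, P(Uu − Tu)⟫| ≤ ηm √𝔇(u) √𝔇†(y) + slop` with `ηm ≥ 10 ηz`
(`z_block`).  Pure Hilbert-space bookkeeping on `V2`; NOT a proof of the stub, of the crux, or of AD; rung F-D1.A0.
-/

set_option linter.dupNamespace false

noncomputable section

namespace Summit.AnomalousDissipation.AnomalousDissipation.Theorems.SolenoidalFractalHomogenisation.LagrangianStep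

open Literature.Analysis Literature.Analysis.FunctionSpaces
open MeasureTheory Set Filter UnitAddTorus
open scoped ENNReal NNReal InnerProductSpace Classical
open OneLevelSplit

/-- `0 ∈ freqBall L`. -/
theorem zero_mem_freqBall (L : ℕ) : (0 : Fin 3 → ℤ) ∈ Torus.freqBall L := by
  rw [Torus.mem_freqBall]
  simp only [Torus.freqNormSq, Pi.zero_apply, Int.cast_zero, ne_eq, OfNat.ofNat_ne_zero, not_false_eq_true, zero_pow,
    Finset.sum_const_zero]
  positivity

/-- The slow-low set `freqBall L ∖ {0}` is symmetric. -/
theorem mem_slowLow_symm (L : ℕ) (k : Fin 3 → ℤ) :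
    k ∈ (Torus.freqBall L).erase 0 ↔ -k ∈ (Torus.freqBall L).erase 0 := by
  simp only [Finset.mem_erase, ne_eq, neg_eq_zero, Torus.mem_freqBall, Torus.freqNormSq_neg]

/-- Removing the zero mode costs exactly its energy: if `𝓕y₀ = 𝓕y` off `0` and `𝓕y₀(0) = 0` then `‖y₀‖² + ‖𝓕y(0)‖² = ‖y‖²`. -/
theorem norm_sq_meanfree_add {y y₀ : V2}
    (hy₀ : ∀ k, mFourierCoeff (EuclideanSpace.complexify ∘ ⇑y₀) k
      = if k = 0 then 0 else mFourierCoeff (EuclideanSpace.complexify ∘ ⇑y) k) :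
    ‖y₀‖ ^ 2 + ‖mFourierCoeff (EuclideanSpace.complexify ∘ ⇑y) 0‖ ^ 2 = ‖y‖ ^ 2 := by
  have hPy := hasSum_norm_sq_fcoeff y
  have hPy₀ := hasSum_norm_sq_fcoeff y₀
  have h2 : HasSum (fun k : Fin 3 → ℤ => ‖mFourierCoeff (EuclideanSpace.complexify ∘ ⇑y₀) k‖ ^ 2
      + (if k = 0 then ‖mFourierCoeff (EuclideanSpace.complexify ∘ ⇑y) 0‖ ^ 2 else 0))
      (‖y₀‖ ^ 2 + ‖mFourierCoeff (EuclideanSpace.complexify ∘ ⇑y) 0‖ ^ 2) := hPy₀.add (hasSum_ite_eq 0 _)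
  have heq : (fun k : Fin 3 → ℤ => ‖mFourierCoeff (EuclideanSpace.complexify ∘ ⇑y₀) k‖ ^ 2
      + (if k = 0 then ‖mFourierCoeff (EuclideanSpace.complexify ∘ ⇑y) 0‖ ^ 2 else 0))
      = fun k => ‖mFourierCoeff (EuclideanSpace.complexify ∘ ⇑y) k‖ ^ 2 := by
    funext k
    by_cases hk : k = 0
    · subst hk; rw [hy₀]; simp
    · rw [hy₀]; simp [hk]
  rw [heq] at h2
  exact h2.unique hPy

/-- **Floor for the mean-free part.**  From the W3-E (i) bound `‖T y‖² ≤ ‖y‖² − ½ Σ' w_k ‖𝓕y(k)‖²` with weights `w ≥ 0`, `= 1` off `freqBall L`,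
the floor of `z_of_pieces` for the mean-free part `y₀` of `y` on `S = freqBall L ∖ {0}`, against the drop of `y` itself:
`½(Σ_S w_k‖𝓕y₀(k)‖² + (‖y₀‖² − Σ_S ‖𝓕y₀(k)‖²)) ≤ ‖y‖² − ‖T y‖²`. -/
theorem floor_meanfree (L : ℕ) (T : V2 →L[ℝ] V2) (y y₀ : V2) (w : (Fin 3 → ℤ) → ℝ) (hw0 : ∀ k, 0 ≤ w k)
    (hw1 : ∀ k, k ∉ Torus.freqBall L → w k = 1)
    (hy₀ : ∀ k, mFourierCoeff (EuclideanSpace.complexify ∘ ⇑y₀) k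
      = if k = 0 then 0 else mFourierCoeff (EuclideanSpace.complexify ∘ ⇑y) k)
    (hT : ‖T y‖ ^ 2 ≤ ‖y‖ ^ 2 - 1 / 2 * ∑' k, w k * ‖mFourierCoeff (EuclideanSpace.complexify ∘ ⇑y) k‖ ^ 2) :
    1 / 2 * (∑ k ∈ (Torus.freqBall L).erase 0, w k * ‖mFourierCoeff (EuclideanSpace.complexify ∘ ⇑y₀) k‖ ^ 2
        + (‖y₀‖ ^ 2 - ∑ k ∈ (Torus.freqBall L).erase 0, ‖mFourierCoeff (EuclideanSpace.complexify ∘ ⇑y₀) k‖ ^ 2))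
      ≤ ‖y‖ ^ 2 - ‖T y‖ ^ 2 := by
  have h := floor_of_dissipBound (Torus.freqBall L) T y w hw1 hT
  have h0 := zero_mem_freqBall L
  have e1 := Finset.add_sum_erase (Torus.freqBall L)
    (fun k : Fin 3 → ℤ => w k * ‖mFourierCoeff (EuclideanSpace.complexify ∘ ⇑y) k‖ ^ 2) h0
  have e2 := Finset.add_sum_erase (Torus.freqBall L)
    (fun k : Fin 3 → ℤ => ‖mFourierCoeff (EuclideanSpace.complexify ∘ ⇑y) k‖ ^ 2) h0
  have hne : ∀ k : Fin 3 → ℤ, k ∈ (Torus.freqBall L).erase 0 → k ≠ 0 := fun k hk => (Finset.mem_erase.1 hk).1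
  have e3 : ∑ k ∈ (Torus.freqBall L).erase 0, w k * ‖mFourierCoeff (EuclideanSpace.complexify ∘ ⇑y₀) k‖ ^ 2
      = ∑ k ∈ (Torus.freqBall L).erase 0, w k * ‖mFourierCoeff (EuclideanSpace.complexify ∘ ⇑y) k‖ ^ 2 :=
    Finset.sum_congr rfl fun k hk => by rw [hy₀, if_neg (hne k hk)]
  have e4 : ∑ k ∈ (Torus.freqBall L).erase 0, ‖mFourierCoeff (EuclideanSpace.complexify ∘ ⇑y₀) k‖ ^ 2
      = ∑ k ∈ (Torus.freqBall L).erase 0, ‖mFourierCoeff (EuclideanSpace.complexify ∘ ⇑y) k‖ ^ 2 :=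
    Finset.sum_congr rfl fun k hk => by rw [hy₀, if_neg (hne k hk)]
  have e5 := norm_sq_meanfree_add hy₀
  have hw00 : 0 ≤ w 0 * ‖mFourierCoeff (EuclideanSpace.complexify ∘ ⇑y) 0‖ ^ 2 := mul_nonneg (hw0 0) (sq_nonneg _)
  rw [e3, e4]
  linarith

/-- **THE (Z) BLOCK.**  See the module docstring.  `S = freqBall L ∖ {0}`; weights `min(1, rate_k τ)`; `P₀` the zero-mode projector; the pieces and
their bounds are the (Zin) text of split v28 §9 at one window; the two dissipation bounds are W3-E §4c (i) for `T` (at `u`) and `T†` (at `y`). -/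
theorem z_block (L : ℕ) (S : Finset (Fin 3 → ℤ)) (hS : S = (Torus.freqBall L).erase 0) (T U P P₀ : V2 →L[ℝ] V2)
    (u y e_d e_c e_l e_f : V2) (rate : (Fin 3 → ℤ) → ℝ) {τ ηz ηm slop : ℝ}
    (hP₀ : ∀ (y : V2) (k : Fin 3 → ℤ), mFourierCoeff (EuclideanSpace.complexify ∘ ⇑(P₀ y)) k
      = if k = 0 then mFourierCoeff (EuclideanSpace.complexify ∘ ⇑y) k else 0)
    (hsplit : P (U u - T u) = e_d + e_c + e_l + e_f)
    (he0 : mFourierCoeff (EuclideanSpace.complexify ∘ ⇑(P (U u - T u))) 0 = 0)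
    (hu0 : mFourierCoeff (EuclideanSpace.complexify ∘ ⇑u) 0 = 0)
    (hrate0 : ∀ k, 0 ≤ rate k) (hrate : ∀ k, k ≠ 0 → 0 < rate k) (hτ : 0 < τ)
    (hoff : ∀ k, k ∉ Torus.freqBall L → 1 ≤ rate k * τ)
    (hTu : ‖T u‖ ^ 2 ≤ ‖u‖ ^ 2 - 1 / 2 * ∑' k, min 1 (rate k * τ) * ‖mFourierCoeff (EuclideanSpace.complexify ∘ ⇑u) k‖ ^ 2)
    (hTy : ‖ContinuousLinearMap.adjoint T y‖ ^ 2
      ≤ ‖y‖ ^ 2 - 1 / 2 * ∑' k, min 1 (rate k * τ) * ‖mFourierCoeff (EuclideanSpace.complexify ∘ ⇑y) k‖ ^ 2)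
    (hd_supp : ∀ k, k ∉ S → mFourierCoeff (EuclideanSpace.complexify ∘ ⇑e_d) k = 0)
    (hl_supp : ∀ k, k ∉ S → mFourierCoeff (EuclideanSpace.complexify ∘ ⇑e_l) k = 0)
    (hf_supp : ∀ k, k ∈ S → mFourierCoeff (EuclideanSpace.complexify ∘ ⇑e_f) k = 0)
    (hdiag : ∀ k, k ∈ S → ‖mFourierCoeff (EuclideanSpace.complexify ∘ ⇑e_d) k‖
      ≤ ηz * min 1 (rate k * τ) * ‖mFourierCoeff (EuclideanSpace.complexify ∘ ⇑u) k‖)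
    (hcross : ∀ y' : V2, |⟪y', e_c⟫_ℝ| ≤ ηz
      * Real.sqrt (∑ k ∈ S, min 1 (rate k * τ) * ‖mFourierCoeff (EuclideanSpace.complexify ∘ ⇑u) k‖ ^ 2
          + (‖u‖ ^ 2 - ∑ k ∈ S, ‖mFourierCoeff (EuclideanSpace.complexify ∘ ⇑u) k‖ ^ 2))
      * Real.sqrt (∑ k ∈ S, min 1 (rate k * τ) * ‖mFourierCoeff (EuclideanSpace.complexify ∘ ⇑y') k‖ ^ 2
          + (‖y'‖ ^ 2 - ∑ k ∈ S, ‖mFourierCoeff (EuclideanSpace.complexify ∘ ⇑y') k‖ ^ 2)))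
    (hleak : ∑ k ∈ S, ‖mFourierCoeff (EuclideanSpace.complexify ∘ ⇑e_l) k‖ ^ 2 / (ηz ^ 2 * min 1 (rate k * τ))
      ≤ ‖u‖ ^ 2 - ∑ k ∈ S, ‖mFourierCoeff (EuclideanSpace.complexify ∘ ⇑u) k‖ ^ 2)
    (hfast : ‖e_f‖ ≤ Real.sqrt (∑ k ∈ S, ηz ^ 2 * min 1 (rate k * τ) * ‖mFourierCoeff (EuclideanSpace.complexify ∘ ⇑u) k‖ ^ 2)
      + ηz * Real.sqrt (‖u‖ ^ 2 - ∑ k ∈ S, ‖mFourierCoeff (EuclideanSpace.complexify ∘ ⇑u) k‖ ^ 2))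
    (hηz : 0 < ηz) (hηm : 10 * ηz ≤ ηm) (hslop : 0 ≤ slop) :
    |⟪y, P (U u - T u)⟫_ℝ| ≤ ηm * Real.sqrt (‖u‖ ^ 2 - ‖T u‖ ^ 2) * Real.sqrt (‖y‖ ^ 2 - ‖ContinuousLinearMap.adjoint T y‖ ^ 2)
      + slop := by
  have hne : ∀ k ∈ S, k ≠ 0 := fun k hk => by rw [hS] at hk; exact (Finset.mem_erase.1 hk).1
  have hSsym : ∀ k, k ∈ S ↔ -k ∈ S := fun k => by rw [hS]; exact mem_slowLow_symm L k
  -- the weights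
  set d : (Fin 3 → ℤ) → ℝ := fun k => if k ∈ S then min 1 (rate k * τ) else 1 with hd_def
  have hdS : ∀ k ∈ S, d k = min 1 (rate k * τ) := fun k hk => by rw [hd_def]; exact if_pos hk
  have hd0 : ∀ k, 0 ≤ d k := fun k => by
    by_cases hk : k ∈ S
    · rw [hdS k hk]; exact le_min zero_le_one (mul_nonneg (hrate0 k) hτ.le)
    · rw [hd_def]; simp only [hk, if_false]; exact zero_le_one
  have hdpos : ∀ k, 0 < d k := fun k => by
    by_cases hk : k ∈ S
    · rw [hdS k hk]; exact lt_min zero_lt_one (mul_pos (hrate k (hne k hk)) hτ)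
    · rw [hd_def]; simp only [hk, if_false]; exact zero_lt_one
  have hw0 : ∀ k, 0 ≤ min 1 (rate k * τ) := fun k => le_min zero_le_one (mul_nonneg (hrate0 k) hτ.le)
  have hw1 : ∀ k, k ∉ Torus.freqBall L → min 1 (rate k * τ) = 1 := fun k hk => min_eq_left (hoff k hk)
  -- the mean-free test vector
  set y₀ : V2 := y - P₀ y with hy₀_def
  have hy₀c : ∀ k, mFourierCoeff (EuclideanSpace.complexify ∘ ⇑y₀) k
      = if k = 0 then 0 else mFourierCoeff (EuclideanSpace.complexify ∘ ⇑y) k := by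
    intro k; rw [hy₀_def, fcoeff_sub, hP₀]
    by_cases hk : k = 0
    · simp [hk]
    · simp [hk]
  have huc : ∀ k, mFourierCoeff (EuclideanSpace.complexify ∘ ⇑u) k
      = if k = 0 then 0 else mFourierCoeff (EuclideanSpace.complexify ∘ ⇑u) k := by
    intro k
    by_cases hk : k = 0
    · subst hk; simp [hu0]
    · simp [hk]
  -- the floors
  have hDu := floor_meanfree L T u u (fun k => min 1 (rate k * τ)) hw0 hw1 huc hTu
  have hDy := floor_meanfree L (ContinuousLinearMap.adjoint T) y y₀ (fun k => min 1 (rate k * τ)) hw0 hw1 hy₀c hTy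
  rw [← hS] at hDu hDy
  have eU : ∑ k ∈ S, d k * ‖mFourierCoeff (EuclideanSpace.complexify ∘ ⇑u) k‖ ^ 2
      = ∑ k ∈ S, min 1 (rate k * τ) * ‖mFourierCoeff (EuclideanSpace.complexify ∘ ⇑u) k‖ ^ 2 :=
    Finset.sum_congr rfl fun k hk => by rw [hdS k hk]
  have eY : ∑ k ∈ S, d k * ‖mFourierCoeff (EuclideanSpace.complexify ∘ ⇑y₀) k‖ ^ 2
      = ∑ k ∈ S, min 1 (rate k * τ) * ‖mFourierCoeff (EuclideanSpace.complexify ∘ ⇑y₀) k‖ ^ 2 :=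
    Finset.sum_congr rfl fun k hk => by rw [hdS k hk]
  have eK : ∑ k ∈ S, ηz ^ 2 * d k * ‖mFourierCoeff (EuclideanSpace.complexify ∘ ⇑u) k‖ ^ 2
      = ∑ k ∈ S, ηz ^ 2 * min 1 (rate k * τ) * ‖mFourierCoeff (EuclideanSpace.complexify ∘ ⇑u) k‖ ^ 2 :=
    Finset.sum_congr rfl fun k hk => by rw [hdS k hk]
  have eL : ∑ k ∈ S, ‖mFourierCoeff (EuclideanSpace.complexify ∘ ⇑e_l) k‖ ^ 2 / (ηz ^ 2 * d k)
      = ∑ k ∈ S, ‖mFourierCoeff (EuclideanSpace.complexify ∘ ⇑e_l) k‖ ^ 2 / (ηz ^ 2 * min 1 (rate k * τ)) :=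
    Finset.sum_congr rfl fun k hk => by rw [hdS k hk]
  -- `z_of_pieces` for the mean-free test vector
  have hz := z_of_pieces S hSsym u y₀ (P (U u - T u)) e_d e_c e_l e_f d (fun k => ηz ^ 2 * d k) (fun k => ηz ^ 2 * d k)
    (D := ‖u‖ ^ 2 - ‖T u‖ ^ 2) (Dstar := ‖y‖ ^ 2 - ‖ContinuousLinearMap.adjoint T y‖ ^ 2) (c := 1 / 2)
    (η₁ := ηz) (η₂ := ηz) (η₃ := ηz) (η₄ := ηz) (η₅ := ηz)
    hsplit hd0 (by norm_num) hηz.le hηz.le hηz.le hηz.le hηz.le (fun k => le_rfl) (fun k => le_rfl)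
    (fun k => mul_pos (pow_pos hηz 2) (hdpos k)) hd_supp hl_supp hf_supp
    (fun k hk => by rw [hdS k hk]; exact hdiag k hk)
    (by rw [eU, eY]; exact hcross y₀)
    (by rw [eL]; exact hleak)
    (by rw [eK]; exact hfast)
    (by rw [eU]; exact hDu)
    (by rw [eY]; exact hDy)
  -- the zero mode of `y` does not see `e`
  have hsplit_y : y = y₀ + P₀ y := by rw [hy₀_def, sub_add_cancel]
  have horth : ⟪P₀ y, P (U u - T u)⟫_ℝ = 0 := inner_eq_zero_of_disjoint_fcoeff fun k => by
    by_cases hk : k = 0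
    · right; subst hk; exact he0
    · left; rw [hP₀, if_neg hk]
  have hyy : ⟪y, P (U u - T u)⟫_ℝ = ⟪y₀, P (U u - T u)⟫_ℝ := by
    conv_lhs => rw [hsplit_y]
    rw [inner_add_left, horth, add_zero]
  rw [hyy]
  have hsq1 : 0 ≤ Real.sqrt (‖u‖ ^ 2 - ‖T u‖ ^ 2) := Real.sqrt_nonneg _
  have hsq2 : 0 ≤ Real.sqrt (‖y‖ ^ 2 - ‖ContinuousLinearMap.adjoint T y‖ ^ 2) := Real.sqrt_nonneg _
  have hcoef : (ηz + ηz + ηz + ηz + ηz) / (1 / 2) ≤ ηm := by linarith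
  calc |⟪y₀, P (U u - T u)⟫_ℝ|
      ≤ (ηz + ηz + ηz + ηz + ηz) / (1 / 2) * Real.sqrt (‖u‖ ^ 2 - ‖T u‖ ^ 2)
          * Real.sqrt (‖y‖ ^ 2 - ‖ContinuousLinearMap.adjoint T y‖ ^ 2) := hz
    _ ≤ ηm * Real.sqrt (‖u‖ ^ 2 - ‖T u‖ ^ 2) * Real.sqrt (‖y‖ ^ 2 - ‖ContinuousLinearMap.adjoint T y‖ ^ 2) + slop := by
        have := mul_le_mul_of_nonneg_right (mul_le_mul_of_nonneg_right hcoef hsq1) hsq2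
        linarith

end Summit.AnomalousDissipation.AnomalousDissipation.Theorems.SolenoidalFractalHomogenisation.LagrangianStep
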